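import Summits.Langlands.Langlands.Theses.ParityBlindBianchi
import Summits.Langlands.Langlands.Theorems.ParityBlindBianchiIcosahedralDescentLevelR
import Summits.Langlands.Langlands.Theorems.IcosahedralDescentLevel.Negative.DoorOfInhabited

/-!
# Disproof of `IcosahedralDescentLevelBC` (stmt-Langlands-16852, D″ of route ParityBlindBianchi) — findings

Refuter crux work file (cdisprove, cycle 1, 2026-08-17).  Prose only in docstrings; every
`theorem` below is kernel-checked (0 sorry).  LANDED (importable): p143315
`Theorems/IcosahedralDescentLevelBC/Negative/WithoutH0.lean` (`withoutH0_iff`,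
`allParity_of_withoutH0_of_inhabited`, `not_icosahedralDescentLevelBC_imp`,
`not_icosahedralDescentLevelBC_shape`, namespace `…Theorems.IcosahedralDescentLevelBC.Negative`).
The crux is
`QuadraticDescentGL2 → QuadraticBaseChangeGL2 → IcosahedralDescentLevelR` (`crux_iff_descentR`,
`Iff.rfl`): the REPAIRED uniform quadratic descent `ℚ ← K` (bad set `S₀ ∌ 0`, uniform over all
2-split imaginary quadratic `K`) with the promoted in-print cruxes QD (A–C III.4.2 (d) at `n = 2`)
and QBC (III.4.2 (a), 5.1 at `n = 2`) as antecedents.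

VERDICT OF THIS CYCLE: NO KILL IS POSSIBLE SHORT OF REFUTING A THEOREM IN PRINT AS TYPED.

FINDINGS (index):

* §1 WHY IT RESISTS.  `F1 → F2 → F3 → F4 → crux` is kernel-checked in the tree
  (`crux_of_facts`, from p125164 `icosahedralDescentLevelR_of_facts`; the antecedents QD/QBC are
  not even used), so `¬ crux → ¬ (F1 ∧ F2 ∧ F3 ∧ F4)` (`not_crux_refutes_baseChange_facts`): a
  refutation of D″ is a refutation of one of Arthur–Clozel III.4.2 (d) / III.5.1 / III.4.2 (a) /
  III.3.1 AS TYPED (all-rank named facts of `Literature/NumberTheory/Automorphic`).  Sharper, from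
  the ideators' evidence `IDEATE-r1-k1-Sketch.lean` (sha f74d697e…, rc 0, 0 sorry, not importable
  here): `F4 → crux` and even `JS (2.2)@s=1 (n = 2) ∧ multiplicity_one_gl 2 → crux`
  (card gl1-shift-killing), so a kill would refute Jacquet–Shalika (2.2) at `s = 1` for
  `GL₂ × GL₂` or multiplicity one for `GL₂` as typed.  Shape of a would-be counterexample
  (`not_crux_gives_descent_counterexample`): QD and QBC hold, yet some irreducible icosahedral
  `ρ/ℚ` is cuspidal-automorphic over EVERY 2-split imaginary quadratic `K` at one uniform level
  `S₀ ∌ 0` while NO cuspidal `π` on `GL₂(𝔸_ℚ)` matches `ρ` a.e. — i.e. a failure of quadratic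
  descent in the presence of quadratic descent.  Not expected; no finite or degenerate model of the
  Borel–Jacquet datum `CuspidalAutomorphicRepData 2 K _` is constructible (no cusp form has been
  built in the tree), so no junk instance is available either.
* §2 LOAD-BEARING ANALYSIS (as theorems where a theorem exists).
  - `0 ∉ S₀` — LOAD-BEARING, and the repair is COMPLETE for the BC form too:
    `(QD → QBC → D′) ↔ crux ∧ (QD → QBC → Door)` (`withoutH0_iff`), the Door being all-parity
    icosahedral strong Artin over `ℚ` relative to bare cuspidal inhabitation
    (`allParity_of_withoutH0`; sibling Negative p98657 `DoorOfInhabited`).  No `_false_without_h0`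
    can be landed: `¬ (QD → QBC → D′)` needs a NON-automorphic icosahedral `ρ/ℚ` (Artin-hard,
    `not_withoutH0_iff`).
  - `hirr`, `hA5` (irreducible, projective image `A₅`) — IDLE: the tree's proof descends ANY
    `ρ : FramedGaloisRep ℚ ℂ 2` from a uniform family (`strong_of_facts`; information for the
    planner: D″ could be filed for all rank-two Artin `ρ`).
  - the antecedents QD, QBC — IDLE given F1–F3 (they exist for the XL-apex citation policy only);
    with F4 alone cited, QD and QBC clauses (a),(b) are consumed at `(2, ℚ, ℚ(√-D))`, clauses
    (c),(d) of QBC are idle in this crux (they serve E1″).  `F1 → QD`, `F3 → QBC(a)`, `F2 = QBC(b)`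
    at `n = 2` (grounder probes on items 16811/16812): the antecedents are consistent relative to
    the Literature facts, so the crux is not vacuous for a cheap reason.
  - the model clause `ι ∘ σ = ρ|_K` — FREE as a constraint on `σ` (sibling
    `exists_entrywise_twoAdicModel`), LOAD-BEARING as the link `π_K ↔ ρ` (without it the family
    says nothing about `ρ`; the mutilated crux is again all-icosahedral strong Artin relative to
    the existence of one compatible pair `(σ, π_K)` per field — not refutable).
  - "compatible at EVERY good place of `K`, `S₀` uniform in `K`" — LOAD-BEARING by the route's
    rev-8 analysis (a `K`-dependent exceptional set leaves an uncontrolled sign-defect set;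
    Artin-hard); no faithful finite shadow; nothing to land.
  - `IsTotallyComplex K`, `finrank ℚ K = 2`, `2` split, `ι` fixed — only SHRINK the family
    (weaker hypothesis, stronger crux); harmless; the `K`-range is non-empty (`exists_admissible_field`:
    `ℚ(√-15)`), so the family hypothesis is not vacuous by emptiness of its index set.
* §3 DEGENERATE SECTORS.  `S₀ = ∅` is admitted (`0 ∉ ∅`): then EVERY finite place of every `K` is
  good and `SatakeFrobCompatibleAt` demands `σ` unramified there (conjunctive `∃`, fail-safe), so
  the family exists only if `ρ|_K` is unramified at all finite places of every 2-split `K` —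
  false for `K` unramified at a ramified prime of `ρ` (Minkowski: `ρ` ramifies somewhere); the
  sector is VACUOUS (hypothesis false), not junk-true; not formalised (needs ramification theory of
  `FramedGaloisRep.IsUnramifiedAt` the tree lacks).  `2 ∉ S₀` admitted: harmless (more good places
  = stronger hypothesis).  Composite / repeated entries of `S₀`: harmless (`good_iff` is about
  membership of `(ℓ : 𝓞 K)` in `w`).
* §4 NATURAL STRENGTHENINGS.  (i) drop `0 ∉ S₀`: adds exactly the Door (§2).  (ii) conclusion at
  EVERY finite place of `ℚ` instead of `∀ᶠ`: false as soon as `ρ` ramifies (always), but only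
  modulo the (unconstructible) family — not landed.  (iii) non-uniform bad set `∀ K ∃ S_K`: the
  retired rev-7 D, equivalent to finiteness of the sign-defect set (route NUMBERS) — Artin-hard,
  not refutable here.  (iv) uniqueness of the descended `π`: true (strong multiplicity one), not a
  strengthening worth attacking.
* §5 TARGETS: none (no line picked, `payload.targets = []`).  NEAR-MISSES: none needing `sorry`.

Disproof used / cited: sibling crux D′ `Cruxes/IcosahedralDescentLevel/Disproof.lean` §1–§3 and its
landed Negative lemmas p90502 (`AllParityOfDoorOfDescent`) and p98657 (`DoorOfInhabited`), which this
file imports and re-glues over the antecedents QD/QBC.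
-/

set_option linter.dupNamespace false

noncomputable section

open scoped MatrixGroups NumberField
open NumberField IsDedekindDomain Field Filter
open Literature.NumberTheory.Automorphic Literature.NumberTheory.GaloisRepresentations
open Summit.Langlands.Langlands.Theses.ParityBlindBianchi

namespace Summit.Langlands.Langlands.Cruxes.IcosahedralDescentLevelBC.Disproof

/-! ## §0 The pieces of the crux, named -/

/-- The per-field data demanded by the hypothesis of D″ for the bad set `S₀`: a 2-adic model `σ`
of `ρ|_K` (entrywise through `ι`) and a cuspidal `π_K` Satake–Frobenius compatible with `σ` at
every place of `K` over no element of `S₀`.  Verbatim sub-expression of the crux. [folklore] -/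
def UniformFamily (ι : PadicAlgCl 2 ≃+* ℂ) (ρ : FramedGaloisRep ℚ ℂ 2) (S₀ : Finset ℕ) : Prop :=
  ∀ (K : Type) [Field K] [NumberField K], NumberField.IsTotallyComplex K →
    Module.finrank ℚ K = 2 →
    (∃ v w : HeightOneSpectrum (𝓞 K), v ≠ w ∧ ((2 : ℕ) : 𝓞 K) ∈ v.asIdeal ∧
      ((2 : ℕ) : 𝓞 K) ∈ w.asIdeal) →
    ∃ (σ : FramedGaloisRep K (PadicAlgCl 2) 2) (hcpt : isCompact_glFiniteIntegralLevel 2 K)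
      (π : CuspidalAutomorphicRepData 2 K hcpt),
      (∀ (g : absoluteGaloisGroup K) (i j : Fin 2),
        ι ((σ g).val i j) = ((FramedGaloisRep.restrictField K ρ) g).val i j) ∧
      ∀ w : HeightOneSpectrum (𝓞 K), (∀ ℓ ∈ S₀, ((ℓ : ℕ) : 𝓞 K) ∉ w.asIdeal) →
        Summit.Langlands.SatakeFrobCompatibleAt ι π.1 σ w

/-- The conclusion of D″ for `ρ`: strong Artin in Tunnell's a.e. sense.  Verbatim sub-expression
of the crux (and of the route target `EvenIcosahedralStrongArtin`). [folklore] -/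
def ArtinConclusion (ρ : FramedGaloisRep ℚ ℂ 2) : Prop :=
  ∃ (hcpt : isCompact_glFiniteIntegralLevel 2 ℚ) (π : CuspidalAutomorphicRepData 2 ℚ hcpt),
    ∀ᶠ v : HeightOneSpectrum (𝓞 ℚ) in cofinite, ∃ α : Multiset ℂ,
      π.1.HasSatakeParamAt v α ∧ ρ.IsUnramifiedAt v ∧ ρ.HasFrobCharpolyAt v (satakePolynomial α)

/-- `ρ` is irreducible of icosahedral type (the two standing hypotheses of the crux). [folklore] -/
def IsIcosahedral (ρ : FramedGaloisRep ℚ ℂ 2) : Prop :=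
  ρ.toGaloisRep.IsIrreducible ∧
    Nonempty ((Matrix.ProjGenLinGroup.mk.comp ρ.toMonoidHom).range ≃* alternatingGroup (Fin 5))

/-- The crux is, definitionally, the BC/descent-conditional form of the support decl
`IcosahedralDescentLevelR` (D′R, stmt-Langlands-16620). [folklore] -/
theorem crux_iff_descentR :
    IcosahedralDescentLevelBC ↔
      (QuadraticDescentGL2 → QuadraticBaseChangeGL2 → IcosahedralDescentLevelR) :=
  Iff.rfl

/-- The crux re-assembled from the named pieces. [folklore] -/
theorem crux_iff :
    IcosahedralDescentLevelBC ↔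
      (QuadraticDescentGL2 → QuadraticBaseChangeGL2 →
        ∀ (ι : PadicAlgCl 2 ≃+* ℂ) (ρ : FramedGaloisRep ℚ ℂ 2), IsIcosahedral ρ →
          (∃ S₀ : Finset ℕ, (0 : ℕ) ∉ S₀ ∧ UniformFamily ι ρ S₀) → ArtinConclusion ρ) := by
  constructor
  · intro h hQD hQBC ι ρ hico hS
    exact h hQD hQBC ι ρ hico.1 hico.2 hS
  · intro h hQD hQBC ι ρ hirr hA5 hS
    exact h hQD hQBC ι ρ ⟨hirr, hA5⟩ hS

/-! ## §1 Why `¬ crux` resists: the crux is a theorem modulo print -/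

/-- **The crux from the four Arthur–Clozel named facts of the tree** (F1 `cuspidal_descent_cyclic`
III.4.2 (d), F2 `ArthurClozel1989_strongLifting_unramified` III.5.1, F3 `baseChange_cyclic_cuspidal`
III.4.2 (a), F4 `ArthurClozel_fibres_quadratic` III.3.1), by p125164; the antecedents QD, QBC are
IGNORED (`fun _ _`).  So the item is true relative to print, whatever the antecedents say.
[folklore] -/
theorem crux_of_facts (h₁ : cuspidal_descent_cyclic) (h₂ : ArthurClozel1989_strongLifting_unramified)
    (h₃ : baseChange_cyclic_cuspidal) (h₄ : ArthurClozel_fibres_quadratic) :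
    IcosahedralDescentLevelBC :=
  fun _ _ =>
    Summit.Langlands.Langlands.Theorems.IcosahedralDescentLevel.icosahedralDescentLevel_conditional
      h₁ h₂ h₃ h₄

/-- **Any kill refutes a base-change fact as typed**: `¬ crux → ¬ (F1 ∧ F2 ∧ F3 ∧ F4)`.  (With
the ideators' re-plumb, evidence `IDEATE-r1-k1-Sketch.lean`, this sharpens to `¬ crux → ¬ F4` and
to `¬ crux → ¬ (JS (2.2)@1 at n = 2 ∧ multiplicity_one_gl 2)`; those files are not importable
from the tree, so only the four-fact form is certified here.) [folklore] -/
theorem not_crux_refutes_baseChange_facts (h : ¬ IcosahedralDescentLevelBC) :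
    ¬ (cuspidal_descent_cyclic ∧ ArthurClozel1989_strongLifting_unramified ∧
        baseChange_cyclic_cuspidal ∧ ArthurClozel_fibres_quadratic) :=
  fun ⟨h₁, h₂, h₃, h₄⟩ => h (crux_of_facts h₁ h₂ h₃ h₄)

/-- **Shape of a would-be counterexample.**  `¬ crux` unpacks to: quadratic descent AND quadratic
base change for `GL₂` hold as typed, and yet some irreducible icosahedral `ρ/ℚ` carries a uniform
compatible cuspidal family over all 2-split imaginary quadratic fields (bad set `S₀ ∌ 0`) while
NO cuspidal `π` on `GL₂(𝔸_ℚ)` matches `ρ` almost everywhere — a failure of descent in the presence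
of descent (the anchor-and-fibres argument of p111861 derives `π` from exactly these data plus
A–C III.3.1).  Recorded to make the target of any future attack explicit. [folklore] -/
theorem not_crux_gives_descent_counterexample (h : ¬ IcosahedralDescentLevelBC) :
    QuadraticDescentGL2 ∧ QuadraticBaseChangeGL2 ∧
      ∃ (ι : PadicAlgCl 2 ≃+* ℂ) (ρ : FramedGaloisRep ℚ ℂ 2) (S₀ : Finset ℕ),
        IsIcosahedral ρ ∧ (0 : ℕ) ∉ S₀ ∧ UniformFamily ι ρ S₀ ∧ ¬ ArtinConclusion ρ := by
  rw [crux_iff] at h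
  by_contra hc
  apply h
  intro hQD hQBC ι ρ hico hS
  by_contra hconc
  obtain ⟨S₀, h0, hfam⟩ := hS
  exact hc ⟨hQD, hQBC, ι, ρ, S₀, hico, h0, hfam, hconc⟩

/-! ## §2 Load-bearing analysis -/

/-- **D″ minus the repair `0 ∉ S₀`**, in the BC form: the vestigial support decl
`IcosahedralDescentLevel` (D′, stmt-Langlands-15113, refuted-misstated) behind the same
antecedents. [folklore] -/
def WithoutH0 : Prop :=
  QuadraticDescentGL2 → QuadraticBaseChangeGL2 → IcosahedralDescentLevel

/-- **The door** (sibling crux D′, Disproof §1): what the `S₀ ∋ 0` sector asserts — strong Artin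
(a.e.) for EVERY irreducible icosahedral `ρ/ℚ`, odd or even, granted only a 2-adic model of
`ρ|_K` and SOME cuspidal datum on `GL₂/K` for every 2-split imaginary quadratic `K`. [folklore] -/
def IcosahedralArtinDoor : Prop :=
  ∀ (ι : PadicAlgCl 2 ≃+* ℂ) (ρ : FramedGaloisRep ℚ ℂ 2), ρ.toGaloisRep.IsIrreducible →
    Nonempty ((Matrix.ProjGenLinGroup.mk.comp ρ.toMonoidHom).range ≃* alternatingGroup (Fin 5)) →
    (∀ (K : Type) [Field K] [NumberField K], NumberField.IsTotallyComplex K →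
      Module.finrank ℚ K = 2 →
      (∃ v w : HeightOneSpectrum (𝓞 K), v ≠ w ∧ ((2 : ℕ) : 𝓞 K) ∈ v.asIdeal ∧
        ((2 : ℕ) : 𝓞 K) ∈ w.asIdeal) →
      ∃ (σ : FramedGaloisRep K (PadicAlgCl 2) 2) (hcpt : isCompact_glFiniteIntegralLevel 2 K)
        (_π : CuspidalAutomorphicRepData 2 K hcpt),
        ∀ (g : absoluteGaloisGroup K) (i j : Fin 2),
          ι ((σ g).val i j) = ((FramedGaloisRep.restrictField K ρ) g).val i j) →
    ArtinConclusion ρ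

/-- **Bare inhabitation** `H`: one cuspidal automorphic representation datum of `GL₂` over each
2-split imaginary quadratic field (TRUE — base change of any non-CM weight-2 newform —, not
constructible in the tree). [folklore] -/
def CuspidalDataInhabited : Prop :=
  ∀ (K : Type) [Field K] [NumberField K], NumberField.IsTotallyComplex K →
    Module.finrank ℚ K = 2 →
    (∃ v w : HeightOneSpectrum (𝓞 K), v ≠ w ∧ ((2 : ℕ) : 𝓞 K) ∈ v.asIdeal ∧
      ((2 : ℕ) : 𝓞 K) ∈ w.asIdeal) →
    ∃ hcpt : isCompact_glFiniteIntegralLevel 2 K, Nonempty (CuspidalAutomorphicRepData 2 K hcpt)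

/-- **All-parity icosahedral strong Artin over `ℚ`** (a.e.): the route target with its evenness
hypothesis deleted (contains the open even case). [folklore] -/
def AllParityIcosahedralStrongArtin : Prop :=
  ∀ ρ : FramedGaloisRep ℚ ℂ 2, IsIcosahedral ρ → ArtinConclusion ρ

/-- **`0 ∉ S₀` is load-bearing and its repair is complete, BC form**:
`(QD → QBC → D′) ↔ crux ∧ (QD → QBC → Door)` — pure logic over the sibling decomposition
`D′ ↔ D″ ∧ Door` (p98657 `icosahedralDescentLevel_iff_repaired_and_door`). [folklore] -/
theorem withoutH0_iff :
    WithoutH0 ↔ IcosahedralDescentLevelBC ∧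
      (QuadraticDescentGL2 → QuadraticBaseChangeGL2 → IcosahedralArtinDoor) := by
  have key :=
    Summit.Langlands.Langlands.Theorems.IcosahedralDescentLevel.Negative.icosahedralDescentLevel_iff_repaired_and_door
  constructor
  · intro h
    refine ⟨fun hQD hQBC => (key.mp (h hQD hQBC)).1, fun hQD hQBC => (key.mp (h hQD hQBC)).2⟩
  · rintro ⟨hcrux, hdoor⟩ hQD hQBC
    exact key.mpr ⟨hcrux hQD hQBC, hdoor hQD hQBC⟩

/-- **What dropping `0 ∉ S₀` smuggles in**: granted QD, QBC and bare cuspidal inhabitation, the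
un-repaired statement already proves strong Artin for EVERY irreducible icosahedral `ρ/ℚ` — in
particular the route's open rank-0 target with its evenness hypothesis deleted (sibling p98657
`allParity_of_descent_of_inhabited`, re-glued over the antecedents). [folklore] -/
theorem allParity_of_withoutH0 (h : WithoutH0) (hQD : QuadraticDescentGL2)
    (hQBC : QuadraticBaseChangeGL2) (hinh : CuspidalDataInhabited) :
    AllParityIcosahedralStrongArtin := fun ρ hico =>
  Summit.Langlands.Langlands.Theorems.IcosahedralDescentLevel.Negative.allParity_of_descent_of_inhabited
    (h hQD hQBC) hinh ρ hico.1 hico.2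

/-- **Why no `_false_without_h0` can be landed**: `¬ WithoutH0` holds iff the antecedents hold and
D′ fails, and `¬ D′` requires an irreducible icosahedral `ρ/ℚ` with NO matching cuspidal `π`
(sibling Disproof §5 `not_descent_implies_artin_fails`) — a counterexample to strong Artin,
Artin-hard and not expected. [folklore] -/
theorem not_withoutH0_iff :
    ¬ WithoutH0 ↔ QuadraticDescentGL2 ∧ QuadraticBaseChangeGL2 ∧ ¬ IcosahedralDescentLevel := by
  unfold WithoutH0
  tauto

/-- … and such a failure of D′ pins a non-automorphic icosahedral `ρ`. [folklore] -/
theorem not_withoutH0_gives_nonautomorphic (h : ¬ WithoutH0) :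
    ∃ ρ : FramedGaloisRep ℚ ℂ 2, IsIcosahedral ρ ∧ ¬ ArtinConclusion ρ := by
  obtain ⟨-, -, hD⟩ := not_withoutH0_iff.mp h
  by_contra hall
  push Not at hall
  exact hD fun ι ρ hirr hA5 _ => hall ρ ⟨hirr, hA5⟩

/-- **`hirr`, `hA5` are idle**: from F1–F4 the tree descends ANY rank-two `ρ` (no irreducibility,
no `A₅`) from a uniform family with `0 ∉ S₀` (`icosahedralDescentLevel_repaired`, p111861).  The
strengthened statement below (all `ρ`) is therefore exactly as true as the crux; information for
the planner, nothing negative to land. [folklore] -/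
theorem strong_of_facts (h₁ : cuspidal_descent_cyclic) (h₂ : ArthurClozel1989_strongLifting_unramified)
    (h₃ : baseChange_cyclic_cuspidal) (h₄ : ArthurClozel_fibres_quadratic)
    (ι : PadicAlgCl 2 ≃+* ℂ) (ρ : FramedGaloisRep ℚ ℂ 2) (S₀ : Finset ℕ) (h0 : (0 : ℕ) ∉ S₀)
    (hfam : UniformFamily ι ρ S₀) : ArtinConclusion ρ :=
  Summit.Langlands.Langlands.Theorems.IcosahedralDescentLevel.icosahedralDescentLevel_repaired
    h₁ h₂ h₃ h₄ ι ρ S₀ h0 hfam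

/-- **The antecedents are idle given the facts** (the BC form differs from D′R only by citation
policy): relative to F1–F4 the crux and its antecedent-free conclusion D′R are both outright true.
[folklore] -/
theorem descentR_of_facts (h₁ : cuspidal_descent_cyclic) (h₂ : ArthurClozel1989_strongLifting_unramified)
    (h₃ : baseChange_cyclic_cuspidal) (h₄ : ArthurClozel_fibres_quadratic) :
    IcosahedralDescentLevelR :=
  Summit.Langlands.Langlands.Theorems.IcosahedralDescentLevelR.icosahedralDescentLevelR_of_facts
    h₁ h₂ h₃ h₄

/-- **The 2-adic model clause is free** (sibling p98657): for every `ι`, `ρ`, `K` the entrywise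
transport `ι⁻¹ ∘ ρ|_K` IS a framed 2-adic representation.  Hence in `UniformFamily` the model
clause never fails for want of `σ`; it is load-bearing only as the LINK between `π_K` and `ρ`.
[folklore] -/
theorem model_clause_free (ι : PadicAlgCl 2 ≃+* ℂ) (ρ : FramedGaloisRep ℚ ℂ 2)
    (K : Type) [Field K] [NumberField K] :
    ∃ σ : FramedGaloisRep K (PadicAlgCl 2) 2, ∀ (g : absoluteGaloisGroup K) (i j : Fin 2),
      ι ((σ g).val i j) = ((FramedGaloisRep.restrictField K ρ) g).val i j :=
  Summit.Langlands.Langlands.Theorems.IcosahedralDescentLevel.Negative.exists_entrywise_twoAdicModel ι ρ K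

/-- **With `0 ∈ S₀` the family degenerates to bare data** (no good place:
`Negative.no_good_place_of_zero_mem`, p90502) — the mechanism the repair `0 ∉ S₀` shuts. [folklore] -/
theorem uniformFamily_of_zero_mem {ι : PadicAlgCl 2 ≃+* ℂ} {ρ : FramedGaloisRep ℚ ℂ 2}
    {S₀ : Finset ℕ} (h0 : (0 : ℕ) ∈ S₀) (hinh : CuspidalDataInhabited) : UniformFamily ι ρ S₀ := by
  intro K _ _ htc hdeg hsplit
  obtain ⟨hcpt, ⟨π⟩⟩ := hinh K htc hdeg hsplit
  obtain ⟨σ, hσ⟩ := model_clause_free ι ρ K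
  refine ⟨σ, hcpt, π, hσ, fun w hw => ?_⟩
  exact absurd hw
    (Summit.Langlands.Langlands.Theorems.IcosahedralDescentLevel.Negative.no_good_place_of_zero_mem
      h0 K w)

/-- **The index set of the family is non-empty**: `ℚ(√-15)` is an imaginary quadratic field in
which `2` splits, in the exact shape of the crux's binders (so the hypothesis `UniformFamily` is a
genuine demand, not vacuous by emptiness of its range of `K`). [folklore] -/
theorem exists_admissible_field :
    ∃ (K : Type) (_ : Field K) (_ : NumberField K), NumberField.IsTotallyComplex K ∧
      Module.finrank ℚ K = 2 ∧
      ∃ v w : HeightOneSpectrum (𝓞 K), v ≠ w ∧ ((2 : ℕ) : 𝓞 K) ∈ v.asIdeal ∧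
        ((2 : ℕ) : 𝓞 K) ∈ w.asIdeal := by
  haveI : Fact (¬ IsSquare (-((15 : ℕ) : ℚ))) :=
    Summit.Langlands.Langlands.Theorems.IcosahedralQuadraticDescent.fact_not_isSquare_neg_natCast
      (by norm_num)
  refine ⟨QuadraticFamily.sqrtNegField ℚ 15, inferInstance, inferInstance,
    Summit.Langlands.Langlands.Theorems.IcosahedralQuadraticDescent.isTotallyComplex_sqrtNegField
      (by norm_num),
    QuadraticFamily.finrank_sqrtNegField,
    Summit.Langlands.Langlands.Theorems.IcosahedralQuadraticDescent.exists_two_places_two_mem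
      (D := 15) (by norm_num)⟩

/-- **With `0 ∉ S₀` almost every place is good** (the complement of the good set is finite), so
the family hypothesis is a cofinite compatibility demand in every `K` — the sense in which the
crux is "uniform a.e. descent" and NOT the level-free rev-7 statement. (Tree lemma
`eventually_good`, p111861.) [folklore] -/
theorem eventually_good_of_not_mem (S₀ : Finset ℕ) (h0 : (0 : ℕ) ∉ S₀) (K : Type) [Field K]
    [NumberField K] :
    ∀ᶠ w : HeightOneSpectrum (𝓞 K) in cofinite, ∀ ℓ ∈ S₀, ((ℓ : ℕ) : 𝓞 K) ∉ w.asIdeal :=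
  Summit.Langlands.Langlands.Theorems.IcosahedralDescentLevel.eventually_good S₀ h0 K

/-! ## §3 Degenerate sectors (remarks; see the module docstring)

* `S₀ = ∅`: admitted by `0 ∉ S₀`; every finite place is then good (`good_of_empty`), and since
  `SatakeFrobCompatibleAt` is a conjunctive `∃` containing `σ.IsUnramifiedAt w`, the family can
  only exist if `ρ|_K` is unramified at every finite place of every 2-split imaginary quadratic
  `K` — impossible (take `K` unramified at a ramified prime of `ρ`; `ρ` ramifies somewhere by
  Minkowski).  VACUOUS sector (false hypothesis), harmless; not formalised.
* `2 ∉ S₀`, composite entries, `1 ∈ S₀` (`(1 : 𝓞 K) ∉ w` always: `1` is never bad) — harmless.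
-/

/-- With `S₀ = ∅` every place is good. [folklore] -/
theorem good_of_empty (K : Type) [Field K] [NumberField K] (w : HeightOneSpectrum (𝓞 K)) :
    ∀ ℓ ∈ (∅ : Finset ℕ), ((ℓ : ℕ) : 𝓞 K) ∉ w.asIdeal := by
  simp

/-- `1 ∈ S₀` excludes no place (`(1 : 𝓞 K)` lies in no prime). [folklore] -/
theorem one_never_bad (K : Type) [Field K] [NumberField K] (w : HeightOneSpectrum (𝓞 K)) :
    ((1 : ℕ) : 𝓞 K) ∉ w.asIdeal := by
  rw [Nat.cast_one]
  exact (Ideal.ne_top_iff_one _).mp w.isPrime.ne_top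

/-- In the compatibility clause the Galois side is demanded UNRAMIFIED at the good place
(conjunctive `∃`): the `S₀ = ∅` sector asks `σ` to be unramified at every finite place. [folklore] -/
theorem isUnramifiedAt_of_compatible {K : Type} [Field K] [NumberField K]
    {hcpt : isCompact_glFiniteIntegralLevel 2 K} (ι : PadicAlgCl 2 ≃+* ℂ)
    (π : CuspidalAutomorphicRepData 2 K hcpt) (σ : FramedGaloisRep K (PadicAlgCl 2) 2)
    (w : HeightOneSpectrum (𝓞 K)) (h : Summit.Langlands.SatakeFrobCompatibleAt ι π.1 σ w) :
    σ.IsUnramifiedAt w := by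
  obtain ⟨_, _, hunr, _⟩ := h
  exact hunr

/-! ## §4 Natural strengthenings (remarks in the module docstring; (i) is §2 `withoutH0_iff`) -/

/-! ## §5 Targets / near-misses: none this cycle -/

end Summit.Langlands.Langlands.Cruxes.IcosahedralDescentLevelBC.Disproof

end
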